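import Summits.BirchSwinnertonDyer.BirchSwinnertonDyer.Theorems.PrintCf2RubinValueTwoSeamColemanDictionaryLevelCharacter
import Literature.NumberTheory.EllipticCurves.PAdicOneVariableSeriesFamilyOfColemanCoordModule
import HarnessLib

/-!
# Brick (c) at `p = 2`, the SEAM at one `𝔓` and one unramified level, IN THE MEASURE LANE'S CURRENCY, AT A CHARACTER `χ` OF `Gal(E_m/F)`: the
# weight-`k`, level-`m` reading of the divided series `L` at `X ↦ ζ − 1` as a `χ`-weighted sum of SOCKET MOMENTS `[S⁰] D^k (j(Φ r^σ) ∘ ϑ)` of the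
# one-`𝔓` package (g13's junction (J-i)) — the `χ`-twin of `…SeamColemanDictionaryLevelMeasure` (T10₀-measure)

Cell `bsd-print-cf2`, width seat `bsd-line-cf2c-w7` g32, route C `PrintCf2RubinValueTwo`, crux of record stmt-BirchSwinnertonDyer-24033
`TwoVariableMainConjAtSplitTwoQuad` (23720 nominal), BRICK §4(c), memo v13.1 (M2)(i)′; `--supports` the crux as a helper.  THEOREMS ONLY (0 sorry,
no named fact, no definition); Theses-free; β-agnostic.  BSD is not proved by any of this.

`…SeamColemanDictionaryLevelCharacter` (T13-core) reads the (c)-capstone's relation `φ_ε(Σ_j Col β (j)) = (t_v·C g − C n)·L` at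
`(X, T) = (ζ − 1, γ^{k+1} − 1)` in `𝒪_{E'}` (`E' ⊇ E_m` finite, `κ : 𝒪_F⟦X⟧ → 𝒪_{E'}` over `𝒪_F` with `κ(X) = ζ − 1`, `χ(φ_m) = ζ`, `ζ^{p^m} = 1`):
`Σ_σ χ(σ⁻¹)σ(mom_k(r_{β,m})) = (Σ_σ χ(σ⁻¹)σθ_m)·((v^{k+1}κ(g) − n)·tEval_{a_k}(κ L)·mom_k(1))`.  The measure lane reads moments as `[S⁰] mahlerD^[k]` of
the `Θ`-read series in the `𝔾_m`-coordinate `ϑ = compSeriesC` with coefficients `j : 𝒪_{E_m} → UnrCoeff F`; g13's junction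
(`constantCoeff_mahlerD_iterate_subst_compSeriesC_coordToKer`) says `[S⁰] D^k (j(Φ r) ∘ ϑ) = ε_ϑ^k · j(mom_k r)`.  Since `ζ` is NOT in `UnrCoeff F`
(the extension `F(ζ)/F` is ramified), the `χ`-weighted identity is stated in any commutative ring `D` receiving BOTH `UnrCoeff F` (`jD`) and `𝒪_{E'}`
(`j'`) compatibly on `𝒪_{E_m}` (`j' ∘ ι_{E'/E_m} = jD ∘ j`) — posited ring data, like `(E', κ, ζ)`.  THIS file composes the two at `π := u₀·2`:

* ★★★ `sum_character_constantCoeff_mahlerD_iterate_eq_of_colemanDeltaCoinvFun_indexTraceₗ_eq` — under T13-core's hypotheses, for every level `m`,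
  weight `k` with `κ ε = (−1)^{k+1}`, and ring data `(D, jD, j')`:
  **`Σ_{σ ∈ Gal(E_m/F)} j'(χ(σ⁻¹)) · jD([S⁰] D^k (j(Φ(r_{β,m}^σ)) ∘ ϑ)) = jD(ε_ϑ)^k · j'((Σ_σ χ(σ⁻¹)σθ_m)·((v^{k+1}κ(g) − n)·tEval_{a_k}(κ L)·mom_k(1)))`**,
  `r_{β,m}^σ` the `σ`-conjugate of the level-`m` Coleman coordinate (`coordMoment_map_unitBallEquiv`), `j(Φ(r_{β,m})) = j((δ_E g_{β_m})~)` the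
  measure lane's series of `β_m` VERBATIM (`map_coordToKer_relUnitCoordTwo`).

HONEST LABEL: the `χ`-component of the level-`m` identity in the measure lane's currency, GIVEN the posited ring data `(E', κ, ζ)` and `(D, jD, j')`;
with T10₀-measure (`χ = 1`) it covers every character of `Gal(E_m/F)` trivial on the prime-to-`p` part; the gluing over `m` / the period
normalisation ((M2)(ii)(iii)) are NOT here.  NOT progress on 24033 by itself.

## References
* [deShalit1987] E. de Shalit, *Iwasawa theory of elliptic curves with complex multiplication* (1987), I §3.1, §3.4 Lemma (ii), §3.5 (11), §3.7,
  §3.8 (16)–(17); II §4.6 (14), §4.7 (16)–(17), §4.12 (29)–(31); III §1.3.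
-/

noncomputable section

set_option linter.dupNamespace false
set_option autoImplicit false

open scoped PowerSeries.WithPiTopology

namespace Summit.BirchSwinnertonDyer.BirchSwinnertonDyer.Theorems.PrintCf2.SeamColemanDictionaryLevelCharacterMeasure

open ValuativeRel IsLocalRing Field Finset MvPowerSeries
open Literature.NumberTheory.GaloisRepresentations Literature.NumberTheory.GaloisRepresentations.IsNonarchimedeanLocalField
  Literature.NumberTheory.GaloisRepresentations.LubinTate Literature.NumberTheory.PAdicHodge
open Literature.NumberTheory.EllipticCurves
open Summit.BirchSwinnertonDyer.BirchSwinnertonDyer.Theorems.PrintCf2.SeamColemanDictionaryLevelCharacter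

variable {F : Type} [Field F] [ValuativeRel F] [TopologicalSpace F] [IsNonarchimedeanLocalField F]

attribute [local instance] ltNormUniformSpace ltNormIsUniformAddGroup rk1 nF nE fintypeResidueField

variable {p : ℕ} [hp : Fact p.Prime] {d : ℕ} [NeZero d] (hd : d.Coprime p)
-- the absolute Lubin–Tate frame `π = u·2` of the measure lane
variable (h2 : (valuation F).IsUniformizer (((2 : ℕ) : 𝒪[F]) : F)) (u₀ : 𝒪[F]ˣ)
variable (E : ℕ → IntermediateField F (AlgebraicClosure F)) [∀ m, FiniteDimensional F (E m)] [∀ m, Normal F (E m)]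
  [∀ m, IsGalois F (E m)] (hmono : Monotone E) (hE : ∀ m, E m ≤ maxUnramified F) (hdeg : ∀ m, Module.finrank F (E m) = d * p ^ m)
  {σ₀ : absoluteGaloisGroup F} (hσ₀ : IsAbsArithFrob σ₀) (hq : residueFieldCard F = 2)
variable (u : (LTCoeff F)ˣ) (hu : LTCoeff.of F ((u₀ : 𝒪[F]) * ((2 : ℕ) : 𝒪[F])) = residueFieldCard F * u) (γ : 𝒪[F]ˣ)
variable [IsAdicComplete (Ideal.span {intBase F (LTCoeff.of F ((u₀ : 𝒪[F]) * ((2 : ℕ) : 𝒪[F])))}) (PowerSeries 𝒪[F])]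
variable (w : 𝒪[F]ˣ) (hγ : (γ : 𝒪[F]) = 1 + ((u₀ : 𝒪[F]) * ((2 : ℕ) : 𝒪[F])) ^ 2 * w) (ε : PowerSeries (PowerSeries 𝒪[F]))
variable [IsAdicComplete (Ideal.span {(p : 𝒪[F])}) 𝒪[F]]
variable {θ : ∀ m, unitBall (E m)} (hθ : ∀ m, IsIntegralNormalGen (E m) (θ m))
  (hcoh : ∀ m, unitBallTrace (hmono (Nat.le_succ m)) (θ (m + 1)) = θ m)
-- the `𝔾_m`-comparison unit `εϑ` (`σ₀ εϑ = u₀·εϑ`) and the coefficient embedding `j : 𝒪_{E_m} → 𝐃` at the level `m`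
variable {εϑ : (maxUnramifiedCompletion F)ˣ}
  (hεϑ : maxUnramifiedCompletion.galAut F σ₀ (εϑ : maxUnramifiedCompletion F) =
    algebraMap 𝒪[F] (maxUnramifiedCompletion F) (u₀ : 𝒪[F]) * (εϑ : maxUnramifiedCompletion F))

set_option maxHeartbeats 800000 in
include hdeg hE hσ₀ hu in
/-- ★★★ **T13 IN THE MEASURE LANE'S CURRENCY** (`π = u₀·2`, one prime, level `m`, weight `k` with `κ ε = (−1)^{k+1}`, character `χ` of `Gal(E_m/F)` with
`χ(φ_m) = ζ`, `ζ^{p^m} = 1`, ring data `(E', κ, ζ)` and `(D, jD, j')` posited): under the (c)-capstone's relation `φ_ε(Σ_j Col β (j)) = (t_v·C g − C n)·L`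
(`g(0) = 1`),
**`Σ_{σ ∈ Gal(E_m/F)} j'(χ(σ⁻¹)) · jD([S⁰] mahlerD^[k] ((j(Φ(r_{β,m}^σ))) ∘ ϑ)) = jD(ε_ϑ)^k · j'((Σ_σ χ(σ⁻¹)σθ_m)·((v^{k+1}κ(g) − n)·tEval_{a_k}(κ L)·mom_k(1)))`**,
`ε_ϑ = [S]ϑ`, `ϑ = compSeriesC h2 hσ₀ u₀ hεϑ`, `Φ = coordToKer` — the left side is the `χ`-weighted sum over the conjugates of the SOCKET MOMENTS of the
measure lane's series of `β_m`.  The `χ`-component of the level-`m` identity; NOT the gluing over `m`.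
[cite: deShalit1987, I §3.1, §3.4 Lemma (ii), §3.5 (11), §3.8 (16)–(17); II §4.7 (16)–(17), §4.12 (29)–(31)] -/
theorem sum_character_constantCoeff_mahlerD_iterate_eq_of_colemanDeltaCoinvFun_indexTraceₗ_eq
    {β : ∀ m, RelNormCoherentUnits (isUniformizer_unit_mul h2 u₀) (E m)}
    (hβ : ∀ m, (β (m + 1)).baseNorm (isUniformizer_unit_mul h2 u₀) (hmono (Nat.le_succ m)) = β m)
    (v : 𝒪[F]ˣ) (g : PowerSeries 𝒪[F]) (hg : PowerSeries.constantCoeff g = 1) (n : ℕ) (L : PowerSeries (PowerSeries 𝒪[F]))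
    (hL : colemanDeltaCoinvFun (isUniformizer_unit_mul h2 u₀) hq (intBase F) u hu γ (eq_zero_of_C_pi_mul_eq_zero_integer (isUniformizer_unit_mul h2 u₀)) w hγ ε
        (indexTraceₗ (isUniformizer_unit_mul h2 u₀) hq u hu γ (colemanImage hd (isUniformizer_unit_mul h2 u₀) E hmono hE hdeg hσ₀ hq u hu γ hθ hcoh hβ)) =
      (colemanDeltaCoinvFun (isUniformizer_unit_mul h2 u₀) hq (intBase F) u hu γ (eq_zero_of_C_pi_mul_eq_zero_integer (isUniformizer_unit_mul h2 u₀)) w hγ ε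
          (unitTwistₗ (isUniformizer_unit_mul h2 u₀) hq (intBase F) u hu γ v (TActModule.ofPS _ _ 1)) * PowerSeries.C g -
        PowerSeries.C ((n : ℕ) : PowerSeries 𝒪[F])) * L)
    (m k : ℕ) {E' : IntermediateField F (AlgebraicClosure F)} [FiniteDimensional F E'] (hE' : E m ≤ E')
    [IsAdicComplete (Ideal.span {algebraMap (LTCoeff F) (unitBall E') (LTCoeff.of F ((u₀ : 𝒪[F]) * ((2 : ℕ) : 𝒪[F])))}) (unitBall E')]
    (κ : PowerSeries 𝒪[F] →+* unitBall E') (hκ : κ.comp (intBase F) = algebraMap (LTCoeff F) (unitBall E'))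
    (ζ : unitBall E') (hζ : ζ ^ p ^ m = 1) (hκX : κ PowerSeries.X = ζ - 1)
    (χ : (E m ≃ₐ[F] E m) →* unitBall E') (hχ : χ ((absoluteGaloisGroup.toAlgEquiv F σ₀).restrictNormal (E m)) = ζ)
    (hεk : PowerSeries.map κ ε = (-1) ^ (k + 1))
    (j : unitBall (E m) →+* UnrCoeff F)
    (hj : j.comp (algebraMap (LTCoeff F) (unitBall (E m))) = (intToUnrCoeff F).comp (LTCoeff.of F).symm.toRingHom)
    {D : Type*} [CommRing D] (jD : UnrCoeff F →+* D) (j' : unitBall E' →+* D)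
    (hjj : j'.comp (inclUnitBall (F := F) hE' : unitBall (E m) →+* unitBall E') = jD.comp j) :
    ∑ σ : E m ≃ₐ[F] E m, j' (χ σ⁻¹) * jD (PowerSeries.constantCoeff (mahlerD^[k]
        (((coordToKer (isUniformizer_unit_mul h2 u₀) (E m) u
          (PowerSeries.map (unitBallEquiv (E m) σ : unitBall (E m) →+* unitBall (E m))
            (relUnitCoordTwo (isUniformizer_unit_mul h2 u₀) (E m) hq (hE m) hσ₀ u hu (β m)))).map j).subst (compSeriesC h2 hσ₀ u₀ hεϑ)))) =
      jD (PowerSeries.coeff 1 (compSeriesC h2 hσ₀ u₀ hεϑ)) ^ k *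
        j' ((∑ σ : E m ≃ₐ[F] E m, χ σ⁻¹ * inclUnitBall (F := F) hE' (unitBallEquiv (E m) σ (θ m))) *
          ((algebraMap 𝒪[F] (unitBall E') (v : 𝒪[F]) ^ (k + 1) * κ g - (n : unitBall E')) *
            tEval (algebraMap_unit_pow_sub_one_mem (isUniformizer_unit_mul h2 u₀) E' hq γ k) (PowerSeries.map κ L) *
            coordMoment (isUniformizer_unit_mul h2 u₀) E' u k 1)) := by
  have hjj' : ∀ y : unitBall (E m), j' (inclUnitBall (F := F) hE' y) = jD (j y) := fun y ↦ by
    have h := RingHom.congr_fun hjj y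
    rw [RingHom.comp_apply, RingHom.comp_apply, RingHom.coe_coe] at h
    exact h
  rw [← sum_character_coordMoment_relUnitCoordTwo_eq_of_colemanDeltaCoinvFun_indexTraceₗ_eq hd (isUniformizer_unit_mul h2 u₀) E hmono hE hdeg hσ₀ hq
    u hu γ w hγ ε hθ hcoh hβ v g hg n L hL m k hE' κ hκ ζ hζ hκX χ hχ hεk, map_sum, Finset.mul_sum]
  refine Finset.sum_congr rfl fun σ _ ↦ ?_
  rw [constantCoeff_mahlerD_iterate_subst_compSeriesC_coordToKer h2 u₀ (E m) hq u j hj hσ₀ hεϑ,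
    coordMoment_map_unitBallEquiv (isUniformizer_unit_mul h2 u₀) u σ k, map_mul jD, map_pow, map_mul j', hjj']
  ring

end Summit.BirchSwinnertonDyer.BirchSwinnertonDyer.Theorems.PrintCf2.SeamColemanDictionaryLevelCharacterMeasure

end
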